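import Literature.Analysis.FluidPDE.TorusNSSobolevGrowthRate
import Literature.Analysis.FluidPDE.TorusNSSerrinCriterion
import HarnessLib

/-!
# The `Ḣ^s` norm controls its own lifespan: local existence time of classical Navier–Stokes
# solutions on `T³` in terms of `‖u₀‖_{Ḣ^s}`, `1/2 < s < 3/2` (Robinson–Sadowski–Silva 2012)

Analysis/FluidPDE support file (theorems only; no definitions, no named facts).
Search for candidate a priori estimates; no regularity claim.

Robinson–Sadowski–Silva (J. Math. Phys. 53 (2012) 115618) derive in §IV the rate law
`d/dt ‖u‖_s² ≤ c_s ‖u‖_s^{2(2s+1)/(2s−1)}` (`1/2 < s < 3/2`), "showing that the local existence time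
depends only on the norm in `Ḣ^s`"; by the scaling of their §II (`Ḣ^s` scales like `λ^{s−1/2}`,
`T̂_X(a) = c a^{−2/α}`) that time is `≳ ‖u₀‖_{Ḣ^s}^{−4/(2s−1)}`, which is (2.2): the optimal
blow-up rate `‖u(T − t)‖_{Ḣ^s} ≥ c t^{−(2s−1)/4}`. Here the lifespan statement is proved for
classical solutions on the unit torus in CONTINUATION FORM, from the tree's rate law
`NSSobolev.hsSeminorm_sq_deriv_le_rpow` (`TorusNSSobolevGrowthRate`): comparison for
`X' ≤ κ X^β` on closed sub-windows (the regularised Lyapunov function `(X + δ)^{1−β} + (β−1)κt` is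
non-decreasing), the bound `‖u(t)‖²_{Ḣ^s} ≤ 2^{(2s−1)/2}‖u(0)‖²_{Ḣ^s}` while
`T ‖u(0)‖_{Ḣ^s}^{4/(2s−1)} ≤ c₀ ν^{(5−2s)/(2s−1)}`, then `Ḣ^s ⊂ L^{6/(3−2s)}`
(`Torus.exists_rpow_integral_rpow_norm_le_hsSeminorm`) and the Serrin-type continuation
`Torus.classicalNS_continuation_of_Ls_rpow_integral_le`:

* `NSSobolev.continuousOn_tsum_rpow_mul_norm_sq` — continuity in time of the full `Ḣ^s` sum of a
  jointly smooth field on a closed window;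
* `NSSobolev.classicalNS_continuation_of_hsSeminorm_lifespan` — **the `Ḣ^s` lifespan**;
* `NSSobolev.hsSeminorm_sq_le_of_window` — the window bound on a closed window `[a, b]`
  (`(b − a)‖u(a)‖_{Ḣ^s}^{4/(2s−1)} ≤ c₀ν^{(5−2s)/(2s−1)} ⇒ ‖u(t)‖²_{Ḣ^s} ≤ 2^{(2s−1)/2}‖u(a)‖²_{Ḣ^s}`);
* `NSSobolev.hsSeminorm_sq_blowup_rate` — **the `Ḣ^s` blow-up rate (2.2)/(4.2) under
  unboundedness of the `Ḣ^s` norm itself**: `‖u(t)‖²_{Ḣ^s} ≥ (c₀ν^{(5−2s)/(2s−1)}/(T − t))^{(2s−1)/2}`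
  on `[a, T)` (the tree's `Torus.hsSeminorm_blowup_rate` assumes `∫‖u‖^{6/(3−2s)}` unbounded).

Extension: the primed versions `classicalNS_continuation_of_hsSeminorm_lifespan'`,
`hsSeminorm_sq_le_of_window'`, `hsSeminorm_sq_blowup_rate'` cover the whole range `1/2 < s < 5/2`,
`s ≠ 3/2` (Robinson–Sadowski–Silva 2012, §IV: "Thus for `1/2 < s < 3/2` and `3/2 < s < 5/2` we
obtain the rate of blowup in (2.2)"), through `NSSobolev.hsSeminorm_sq_deriv_le_rpow'` (the case
`s > 3/2` resting on the commutator estimate (3.6), `TorusNSSobolevCommutator`); the unprimed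
names keep the original range `1/2 < s < 3/2`;
`hsSeminorm_sq_blowup_rate_of_not_bddAbove_gradNormSq'` — the rate for every `1 ≤ s < 5/2`,
`s ≠ 3/2` under the classical hypothesis that `‖∇u‖₂` is unbounded.

## Mathlib / tree search

Tree: `NSSobolev.hsSeminorm_sq_deriv_le_rpow`, `NSSobolev.exists_forall_pow_four_mul_norm_sq_le`
(`TorusNSSobolevGrowthRate`), `Torus.classicalNS_continuation_of_Ls_rpow_integral_le`
(`TorusNSSerrinCriterion`, RRS 2016 Thm 8.17), `Torus.classicalNS_continuation_of_lqNorm_lifespan`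
(the `L^q` twin, Robinson–Sadowski 2014 Thm 8, `TorusNSLebesgueNormGrowthRate`),
`Torus.IsClassicalNSSolutionOn.mono`; Mathlib `monotoneOn_of_deriv_nonneg`, `continuousOn_tsum`,
`HasDerivAt.rpow_const`.

## References

* J. C. Robinson, W. Sadowski, R. P. Silva, *Lower bounds on blow up solutions of the
  three-dimensional Navier–Stokes equations in homogeneous Sobolev spaces*, J. Math. Phys. 53
  (2012) 115618, §II (2.2), §IV (held: paper:doi-10-1063-1-4762841, pp. 4–5, 9–10).
  [RobinsonSadowskiSilva2012]
* J. C. Robinson, W. Sadowski, *A local smoothness criterion for solutions of the 3D Navier–Stokes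
  equations*, Rend. Semin. Mat. Univ. Padova 131 (2014) 159–178, Thm 8 / Cor 10 (the `L^p` and
  `Ḣ^s` forms). [RobinsonSadowski2014]
-/

noncomputable section

open MeasureTheory Set Filter UnitAddTorus Function Finset
open scoped Topology BigOperators InnerProductSpace ComplexConjugate

namespace Literature.Analysis.FluidPDE

namespace NSSobolev

open Literature.Analysis.FunctionSpaces Literature.Analysis.FunctionSpaces.Torus NSGevrey

variable {d : Type*} [Fintype d] [DecidableEq d]

omit [DecidableEq d] in
/-- The punctured lattice `p`-series `∑_{k≠0} |k|^{-2t}` converges for `2t > n`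
(`|k|^{-2t} ≤ 2^t (1+|k|²)^{-t}` off the origin). [folklore] -/
private theorem summable_ite_freqNormSq_rpow_neg' {t : ℝ} (ht : (Fintype.card d : ℝ) < 2 * t) :
    Summable fun k : d → ℤ => if k = 0 then (0 : ℝ) else freqNormSq k ^ (-t) := by
  classical
  have ht0 : 0 ≤ t := by
    have : (0 : ℝ) ≤ Fintype.card d := Nat.cast_nonneg _
    linarith
  rcases isEmpty_or_nonempty d with hd | hd
  · refine summable_of_ne_finset_zero (s := ∅) fun k _ => ?_
    rw [if_pos (Subsingleton.elim k 0)]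
  have hmaj := (summable_one_add_freqNormSq_rpow_neg (d := d) ht).mul_left ((2 : ℝ) ^ t)
  refine Summable.of_nonneg_of_le (fun k => ?_) (fun k => ?_) hmaj
  · split_ifs
    · exact le_rfl
    · exact Real.rpow_nonneg (freqNormSq_nonneg k) _
  · split_ifs with hk
    · exact mul_nonneg (Real.rpow_nonneg (by norm_num) _)
        (Real.rpow_nonneg (by linarith [freqNormSq_nonneg k]) _)
    · have hm : 1 ≤ freqNormSq k := one_le_freqNormSq_of_ne_zero hk
      have hm0 : 0 < freqNormSq k := by linarith
      have h2 : (freqNormSq k)⁻¹ ≤ 2 / (1 + freqNormSq k) := by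
        rw [inv_eq_one_div, div_le_div_iff₀ hm0 (by linarith)]
        linarith
      calc freqNormSq k ^ (-t) = (freqNormSq k)⁻¹ ^ t := by
            rw [Real.rpow_neg hm0.le, Real.inv_rpow hm0.le]
        _ ≤ (2 / (1 + freqNormSq k)) ^ t := Real.rpow_le_rpow (inv_nonneg.2 hm0.le) h2 ht0
        _ = 2 ^ t * (1 + freqNormSq k) ^ (-t) := by
            rw [Real.div_rpow (by norm_num) (by linarith), Real.rpow_neg (by linarith),
              div_eq_mul_inv]

/-! ### §5 The `Ḣ^s` norm controls its own lifespan -/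

/-- **Continuity in time of the full `Ḣ^s` sum** on a closed window, for a jointly smooth field
(`s > 0`, `n < 8 − 2s`; `continuousOn_tsum` with the majorant of §1).
[cite: RobinsonSadowskiSilva2012, §IV (energy method in `Ḣ^s`)] -/
theorem continuousOn_tsum_rpow_mul_norm_sq {a b : ℝ} (hab : a < b)
    {u : ℝ → UnitAddTorus d → EuclideanSpace ℝ d} (hu : Torus.IsSmoothSpaceTimeOn (Icc a b) u)
    {s : ℝ} (hs : 0 < s) (hsd : (Fintype.card d : ℝ) < 2 * (4 - s)) :
    ContinuousOn (fun τ => ∑' k : d → ℤ,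
      freqNormSq k ^ s * ‖mFourierCoeff (EuclideanSpace.complexify ∘ u τ) k‖ ^ 2) (Icc a b) := by
  classical
  have hU : UniqueDiffOn ℝ (Icc a b) := uniqueDiffOn_Icc hab
  obtain ⟨W₁, hW₁0, hW₁⟩ := exists_forall_pow_four_mul_norm_sq_le hab hu
  set M : (d → ℤ) → ℝ := fun k =>
    W₁ * (if k = 0 then (0 : ℝ) else freqNormSq k ^ (-(4 - s))) with hM
  have hMs : Summable M := (summable_ite_freqNormSq_rpow_neg' (d := d) (by linarith)).mul_left _
  refine continuousOn_tsum (fun k => ?_) hMs (fun k τ hτ => ?_)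
  · exact continuousOn_const.mul (continuousOn_norm_sq_mFourierCoeff hu (convex_Icc a b) hU k)
  · rw [Real.norm_eq_abs, abs_of_nonneg (mul_nonneg (Real.rpow_nonneg (freqNormSq_nonneg k) s)
      (sq_nonneg _))]
    by_cases hk : k = 0
    · have hx : freqNormSq k = 0 := by rw [hk, freqNormSq_zero]
      have hM0 : M k = 0 := by simp only [hM, if_pos hk, mul_zero]
      rw [hx, Real.zero_rpow hs.ne', zero_mul, hM0]
    · have hx : 1 ≤ freqNormSq k := one_le_freqNormSq_of_ne_zero hk
      have hx0 : 0 < freqNormSq k := by linarith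
      have e : freqNormSq k ^ s = freqNormSq k ^ (-(4 - s)) * freqNormSq k ^ 4 := by
        rw [← Real.rpow_natCast (freqNormSq k) 4, ← Real.rpow_add hx0]
        congr 1
        push_cast
        ring
      have hMk : M k = freqNormSq k ^ (-(4 - s)) * W₁ := by
        simp only [hM, if_neg hk]
        ring
      calc freqNormSq k ^ s * ‖mFourierCoeff (EuclideanSpace.complexify ∘ u τ) k‖ ^ 2
          = freqNormSq k ^ (-(4 - s)) *
              (freqNormSq k ^ 4 * ‖mFourierCoeff (EuclideanSpace.complexify ∘ u τ) k‖ ^ 2) := by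
            rw [e]; ring
        _ ≤ freqNormSq k ^ (-(4 - s)) * W₁ :=
            mul_le_mul_of_nonneg_left (hW₁ τ hτ k) (Real.rpow_nonneg (freqNormSq_nonneg k) _)
        _ = M k := hMk.symm

/-- Comparison for `X' ≤ κ X^β` (`β > 1`, `X ≥ 0` continuous on `[a, b]`, differentiable inside),
regularised form: for every `δ > 0` and `t ∈ [a, b]`,
`(X(a) + δ)^{1−β} ≤ (X(t) + δ)^{1−β} + (β − 1) κ (t − a)`
(the function `(X + δ)^{1−β} + (β−1)κ t` is non-decreasing; Robinson–Sadowski–Silva (4.1)). [folklore] -/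
private theorem rpow_add_le_of_deriv_le {X X' : ℝ → ℝ} {a b κ β : ℝ} (hab : a < b) (hκ : 0 ≤ κ)
    (hβ : 1 < β) (hX0 : ∀ t ∈ Icc a b, 0 ≤ X t) (hXc : ContinuousOn X (Icc a b))
    (hXd : ∀ t ∈ Ioo a b, HasDerivAt X (X' t) t) (hX' : ∀ t ∈ Ioo a b, X' t ≤ κ * X t ^ β)
    {δ : ℝ} (hδ : 0 < δ) {t : ℝ} (ht : t ∈ Icc a b) :
    (X a + δ) ^ (1 - β) ≤ (X t + δ) ^ (1 - β) + (β - 1) * κ * (t - a) := by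
  set φ : ℝ → ℝ := fun τ => (X τ + δ) ^ (1 - β) + (β - 1) * κ * τ with hφ
  have hpos : ∀ τ ∈ Icc a b, 0 < X τ + δ := fun τ hτ => by linarith [hX0 τ hτ]
  have hφc : ContinuousOn φ (Icc a b) :=
    ((hXc.add continuousOn_const).rpow_const fun τ hτ => Or.inl (hpos τ hτ).ne').add
      (continuousOn_const.mul continuousOn_id)
  have hφd : ∀ τ ∈ Ioo a b, HasDerivAt φ
      (X' τ * (1 - β) * (X τ + δ) ^ (1 - β - 1) + (β - 1) * κ * 1) τ := fun τ hτ =>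
    (((hXd τ hτ).add_const δ).rpow_const (Or.inl (hpos τ (Ioo_subset_Icc_self hτ)).ne')).add
      ((hasDerivAt_id τ).const_mul ((β - 1) * κ))
  have hφ' : ∀ τ ∈ Ioo a b, 0 ≤ X' τ * (1 - β) * (X τ + δ) ^ (1 - β - 1) + (β - 1) * κ * 1 := by
    intro τ hτ
    have hτ' := Ioo_subset_Icc_self hτ
    have hXτ := hX0 τ hτ'
    have hp := hpos τ hτ'
    rw [show (1 : ℝ) - β - 1 = -β by ring]
    -- `X'(X+δ)^{-β} ≤ κ X^β (X+δ)^{-β} ≤ κ`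
    have h1 : X' τ * (X τ + δ) ^ (-β) ≤ κ := by
      have hb : X τ ^ β ≤ (X τ + δ) ^ β := Real.rpow_le_rpow hXτ (by linarith) (by linarith)
      calc X' τ * (X τ + δ) ^ (-β) ≤ κ * X τ ^ β * (X τ + δ) ^ (-β) :=
            mul_le_mul_of_nonneg_right (hX' τ hτ) (Real.rpow_nonneg hp.le _)
        _ ≤ κ * (X τ + δ) ^ β * (X τ + δ) ^ (-β) :=
            mul_le_mul_of_nonneg_right (mul_le_mul_of_nonneg_left hb hκ) (Real.rpow_nonneg hp.le _)
        _ = κ := by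
            rw [mul_assoc, ← Real.rpow_add hp, add_neg_cancel, Real.rpow_zero, mul_one]
    nlinarith [h1]
  have hmono : MonotoneOn φ (Icc a b) := by
    refine monotoneOn_of_deriv_nonneg (convex_Icc a b) hφc ?_ ?_
    · rw [interior_Icc]
      exact fun τ hτ => (hφd τ hτ).differentiableAt.differentiableWithinAt
    · rw [interior_Icc]
      intro τ hτ
      rw [(hφd τ hτ).deriv]
      exact hφ' τ hτ
  have h := hmono (left_mem_Icc.2 hab.le) ht ht.1
  simp only [hφ] at h
  linarith

/-- (General range `1/2 < s < 5/2`, `s ≠ 3/2` — Robinson–Sadowski–Silva 2012, §IV: "Thus for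
`1/2 < s < 3/2` and `3/2 < s < 5/2` we obtain the rate of blowup in (2.2)"; for `s > 3/2` the rate law
comes from the commutator estimate (3.6), `NSSobolev.hsSeminorm_sq_deriv_le_rpow'`, and the
continuation step uses the level `min s 1`.)
**The `Ḣ^s` norm controls its own lifespan** (Robinson–Sadowski–Silva 2012: the law
`d/dt‖u‖_s² ≤ c_s‖u‖_s^{2(2s+1)/(2s−1)}` shows "that the local existence time depends only on the
norm in `Ḣ^s`", and by the scaling of §II that time is `≳ ‖u₀‖_{Ḣ^s}^{−4/(2s−1)}`;
`1/2 < s < 3/2`), continuation form for classical solutions on `T³` with the viscosity explicit: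
for `card d = 3` and `1/2 < s < 3/2` there is `c₀ = c₀(s) > 0` such that a classical mean-zero
solution on `[0, T) × T³` (zero force) with
`T · (‖u(0)‖²_{Ḣ^s})^{2/(2s−1)} ≤ c₀ ν^{(5−2s)/(2s−1)}` (`‖u‖²_{Ḣ^s} = ∑_k |k|^{2s}‖û(k)‖²`)
satisfies `‖u(t)‖²_{Ḣ^s} ≤ 2^{(2s−1)/2} ‖u(0)‖²_{Ḣ^s}` on `[0, T)` and extends to a classical
mean-zero solution on a strictly longer closed interval (comparison for the rate law
`NSSobolev.hsSeminorm_sq_deriv_le_rpow`, then `Ḣ^s ⊂ L^{6/(3−2s)}`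
(`Torus.exists_rpow_integral_rpow_norm_le_hsSeminorm`) and the Serrin-type continuation
`Torus.classicalNS_continuation_of_Ls_rpow_integral_le`). In particular no `Ḣ^s` blow-up occurs
before time `c₀ ν^{(5−2s)/(2s−1)} ‖u(0)‖_{Ḣ^s}^{−4/(2s−1)}`.
[cite: RobinsonSadowskiSilva2012, §IV with §II (2.2)] -/
theorem classicalNS_continuation_of_hsSeminorm_lifespan' (hd : Fintype.card d = 3) {s : ℝ}
    (hs : 1 / 2 < s) (hs' : s < 5 / 2) (hs3 : s ≠ 3 / 2) :
    ∃ c₀ : ℝ, 0 < c₀ ∧ ∀ {ν T : ℝ}, 0 < ν → 0 < T →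
      ∀ {u : ℝ → UnitAddTorus d → EuclideanSpace ℝ d} {p : ℝ → UnitAddTorus d → ℝ},
      Torus.IsClassicalNSSolutionOn (Ico 0 T) ν 0 u p → (∀ t ∈ Ico 0 T, HasZeroMean (u t)) →
      T * (∑' k : d → ℤ, freqNormSq k ^ s *
          ‖mFourierCoeff (EuclideanSpace.complexify ∘ u 0) k‖ ^ 2) ^ (2 / (2 * s - 1)) ≤
        c₀ * ν ^ ((5 - 2 * s) / (2 * s - 1)) →
      (∀ t ∈ Ico 0 T, (∑' k : d → ℤ, freqNormSq k ^ s *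
          ‖mFourierCoeff (EuclideanSpace.complexify ∘ u t) k‖ ^ 2) ≤
        (2 : ℝ) ^ ((2 * s - 1) / 2) * ∑' k : d → ℤ, freqNormSq k ^ s *
          ‖mFourierCoeff (EuclideanSpace.complexify ∘ u 0) k‖ ^ 2) ∧
      ∃ T' : ℝ, T < T' ∧ ∃ (u' : ℝ → UnitAddTorus d → EuclideanSpace ℝ d)
        (p' : ℝ → UnitAddTorus d → ℝ), Torus.IsClassicalNSSolutionOn (Icc 0 T') ν 0 u' p' ∧
          (∀ t ∈ Icc 0 T', HasZeroMean (u' t)) ∧ ∀ t ∈ Ico 0 T, u' t = u t := by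
  classical
  have hn : (Fintype.card d : ℝ) = 3 := by rw [hd]; norm_num
  obtain ⟨c, hc0, hc⟩ := hsSeminorm_sq_deriv_le_rpow' hd hs hs' hs3
  -- the Sobolev level used for the continuation step: `s₀ = min s 1 ∈ (1/2, 3/2)`, `s₀ ≤ s`
  set s₀ : ℝ := min s 1 with hs₀
  have hs₀0 : 1 / 2 < s₀ := lt_min hs (by norm_num)
  have hs₀1 : s₀ ≤ 1 := min_le_right _ _
  have hs₀s : s₀ ≤ s := min_le_left _ _
  obtain ⟨CE, hCE0, hCE⟩ := exists_rpow_integral_rpow_norm_le_hsSeminorm (d := d) (s := s₀)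
    (by linarith) (by rw [hn]; linarith)
  -- exponents
  set γ : ℝ := 2 / (2 * s - 1) with hγ
  set β : ℝ := (2 * s + 1) / (2 * s - 1) with hβ
  set α : ℝ := (5 - 2 * s) / (2 * s - 1) with hα
  have hs1 : (0 : ℝ) < 2 * s - 1 := by linarith
  have hγ0 : 0 < γ := by rw [hγ]; positivity
  have hβγ : β = 1 + γ := by rw [hβ, hγ]; field_simp; ring
  have hβ1 : 1 < β := by rw [hβγ]; linarith
  set c₀ : ℝ := 1 / (2 * γ * (c + 1)) with hc₀
  have hc₀0 : 0 < c₀ := by rw [hc₀]; positivity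
  refine ⟨c₀, hc₀0, fun {ν T} hν hT {u p} h hmean hsmall => ?_⟩
  set κ : ℝ := c * ν ^ (-α) with hκ
  have hκ0 : 0 ≤ κ := mul_nonneg hc0 (Real.rpow_nonneg hν.le _)
  -- notation for the `Ḣ^s` sum of the slices
  set X : ℝ → ℝ := fun τ => ∑' k : d → ℤ, freqNormSq k ^ s *
    ‖mFourierCoeff (EuclideanSpace.complexify ∘ u τ) k‖ ^ 2 with hX
  have hXnn : ∀ τ, 0 ≤ X τ := fun τ => tsum_nonneg fun k =>
    mul_nonneg (Real.rpow_nonneg (freqNormSq_nonneg k) _) (sq_nonneg _)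
  -- `γ κ T ≤ X(0)^{-γ} / 2` when `X(0) > 0`
  have hTκ : 0 < X 0 → γ * κ * T ≤ (X 0) ^ (-γ) / 2 := by
    intro hX00
    have h1 : T ≤ c₀ * ν ^ α * (X 0) ^ (-γ) := by
      have hXγ : 0 < X 0 ^ γ := Real.rpow_pos_of_pos hX00 γ
      rw [Real.rpow_neg (hXnn 0), ← div_eq_mul_inv, le_div_iff₀ hXγ]
      exact hsmall
    have h2 : γ * κ * (c₀ * ν ^ α * (X 0) ^ (-γ)) ≤ (X 0) ^ (-γ) / 2 := by
      rw [hκ, hc₀]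
      have hνα : ν ^ (-α) * ν ^ α = 1 := by
        rw [← Real.rpow_add hν, neg_add_cancel, Real.rpow_zero]
      have hXγ0 : 0 ≤ X 0 ^ (-γ) := Real.rpow_nonneg (hXnn 0) _
      calc γ * (c * ν ^ (-α)) * (1 / (2 * γ * (c + 1)) * ν ^ α * X 0 ^ (-γ))
          = (c / (c + 1)) * (ν ^ (-α) * ν ^ α) * X 0 ^ (-γ) / 2 := by
            field_simp
        _ ≤ 1 * 1 * X 0 ^ (-γ) / 2 := by
            rw [hνα]
            gcongr
            · rw [div_le_one (by linarith)]; linarith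
        _ = X 0 ^ (-γ) / 2 := by ring
    calc γ * κ * T ≤ γ * κ * (c₀ * ν ^ α * (X 0) ^ (-γ)) :=
          mul_le_mul_of_nonneg_left h1 (mul_nonneg hγ0.le hκ0)
      _ ≤ (X 0) ^ (-γ) / 2 := h2
  -- ### Step A: the bound on `[0, T)` by comparison on the closed windows `[0, T₁]`, `T₁ < T`
  have hbound : ∀ t ∈ Ico 0 T, X t ≤ (2 : ℝ) ^ ((2 * s - 1) / 2) * X 0 := by
    intro t ht
    set T₁ : ℝ := (t + T) / 2 with hT₁
    have htT₁ : t < T₁ := by rw [hT₁]; linarith [ht.2]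
    have hT₁T : T₁ < T := by rw [hT₁]; linarith [ht.2]
    have hT₁0 : 0 < T₁ := lt_of_le_of_lt ht.1 htT₁
    have hsub : Icc 0 T₁ ⊆ Ico 0 T := fun τ hτ => ⟨hτ.1, lt_of_le_of_lt hτ.2 hT₁T⟩
    have h₁ : Torus.IsClassicalNSSolutionOn (Icc 0 T₁) ν 0 u p := h.mono hsub (uniqueDiffOn_Icc hT₁0)
    have hmean₁ : ∀ τ ∈ Icc 0 T₁, HasZeroMean (u τ) := fun τ hτ => hmean τ (hsub hτ)
    have hXc : ContinuousOn X (Icc 0 T₁) :=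
      continuousOn_tsum_rpow_mul_norm_sq hT₁0 h₁.smooth_velocity (by linarith) (by rw [hn]; linarith)
    have hXd : ∀ τ ∈ Ioo 0 T₁, HasDerivAt X (deriv X τ) τ ∧ deriv X τ ≤ κ * X τ ^ β := by
      intro τ hτ
      obtain ⟨D, hD, hle⟩ := hc hν hT₁0 h₁ hmean₁ τ hτ
      refine ⟨hD.differentiableAt.hasDerivAt, ?_⟩
      rw [hD.deriv]
      refine hle.trans ?_
      have hZ0 : 0 ≤ ∑' k : d → ℤ, freqNormSq k ^ (s + 1) *
          ‖mFourierCoeff (EuclideanSpace.complexify ∘ u τ) k‖ ^ 2 := tsum_nonneg fun k =>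
        mul_nonneg (Real.rpow_nonneg (freqNormSq_nonneg k) _) (sq_nonneg _)
      have hneg : -(4 * Real.pi ^ 2 * ν) * (∑' k : d → ℤ, freqNormSq k ^ (s + 1) *
          ‖mFourierCoeff (EuclideanSpace.complexify ∘ u τ) k‖ ^ 2) ≤ 0 :=
        mul_nonpos_of_nonpos_of_nonneg (by have := Real.pi_pos; nlinarith [hν]) hZ0
      have : c * ν ^ (-((5 - 2 * s) / (2 * s - 1))) * X τ ^ ((2 * s + 1) / (2 * s - 1)) =
          κ * X τ ^ β := by rw [hκ, hα, hβ]
      linarith [this]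
    have hcomp := fun (δ : ℝ) (hδ : 0 < δ) =>
      rpow_add_le_of_deriv_le (X := X) (X' := deriv X) hT₁0 hκ0 hβ1 (fun τ _ => hXnn τ) hXc
        (fun τ hτ => (hXd τ hτ).1) (fun τ hτ => (hXd τ hτ).2) hδ
        (show t ∈ Icc 0 T₁ from ⟨ht.1, htT₁.le⟩)
    -- hcomp δ hδ : (X 0 + δ)^(1-β) ≤ (X t + δ)^(1-β) + (β-1) κ (t - 0)
    have h1β : 1 - β = -γ := by rw [hβγ]; ring
    have hβ1' : β - 1 = γ := by rw [hβγ]; ring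
    by_cases hXt : X t = 0
    · rw [hXt]; exact mul_nonneg (Real.rpow_nonneg (by norm_num) _) (hXnn 0)
    have hXt0 : 0 < X t := lt_of_le_of_ne (hXnn t) (Ne.symm hXt)
    have htT : (β - 1) * κ * (t - 0) ≤ γ * κ * T := by
      rw [hβ1', sub_zero]
      exact mul_le_mul_of_nonneg_left ht.2.le (mul_nonneg hγ0.le hκ0)
    -- from the regularised comparison: `(X 0 + δ)^{-γ} ≤ X(t)^{-γ} + γ κ T` for all `δ > 0`
    have hkey : ∀ δ : ℝ, 0 < δ → (X 0 + δ) ^ (-γ) ≤ X t ^ (-γ) + γ * κ * T := by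
      intro δ hδ
      have h1 := hcomp δ hδ
      rw [h1β] at h1
      have h2 : (X t + δ) ^ (-γ) ≤ X t ^ (-γ) :=
        Real.rpow_le_rpow_of_nonpos hXt0 (by linarith) (by linarith)
      linarith
    -- `X 0 > 0` (otherwise `δ^{-γ} ≤ const` for all small `δ`, absurd)
    have hX00 : 0 < X 0 := by
      by_contra hcon
      have hX0z : X 0 = 0 := le_antisymm (not_lt.1 hcon) (hXnn 0)
      set R₀ : ℝ := X t ^ (-γ) + γ * κ * T + 1 with hR₀
      have hR₀0 : 0 < R₀ := by
        have := Real.rpow_nonneg (hXnn t) (-γ)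
        have := mul_nonneg (mul_nonneg hγ0.le hκ0) hT.le
        rw [hR₀]; linarith
      set δ : ℝ := R₀ ^ (-(1 / γ)) with hδ
      have hδ0 : 0 < δ := Real.rpow_pos_of_pos hR₀0 _
      have hδγ : δ ^ (-γ) = R₀ := by
        rw [hδ, ← Real.rpow_mul hR₀0.le, show -(1 / γ) * -γ = 1 by field_simp, Real.rpow_one]
      have := hkey δ hδ0
      rw [hX0z, zero_add, hδγ, hR₀] at this
      linarith
    -- `X 0 ^ {-γ} ≤ X t ^{-γ} + γ κ T` by letting `δ → 0`
    have hlim : (X 0) ^ (-γ) ≤ X t ^ (-γ) + γ * κ * T := by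
      by_contra hcon
      push Not at hcon
      have hcont : Filter.Tendsto (fun δ : ℝ => (X 0 + δ) ^ (-γ)) (𝓝 0) (𝓝 ((X 0) ^ (-γ))) := by
        have h1 : ContinuousAt (fun δ : ℝ => (X 0 + δ) ^ (-γ)) 0 :=
          (continuousAt_const.add continuousAt_id).rpow_const (Or.inl (by simp; exact hX00.ne'))
        have h2 := h1.tendsto
        simp only [add_zero] at h2
        exact h2
      have hev := (hcont.eventually_const_lt hcon).filter_mono (nhdsWithin_le_nhds (s := Ioi (0:ℝ)))
      obtain ⟨δ, hδ0, hδ⟩ := ((eventually_mem_nhdsWithin (a := (0:ℝ)) (s := Ioi 0)).and hev).exists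
      exact absurd (hkey δ hδ0) (not_le.2 hδ)
    -- conclude: `X t ^{-γ} ≥ X 0^{-γ}/2`, i.e. `X t ≤ 2^{1/γ} X 0`
    have hXtγ : (X 0) ^ (-γ) / 2 ≤ X t ^ (-γ) := by linarith [hTκ hX00]
    have hX0γ : 0 < (X 0) ^ (-γ) / 2 := by
      have := Real.rpow_pos_of_pos hX00 (-γ); linarith
    calc X t = (X t ^ (-γ)) ^ (-(1 / γ)) := by
          rw [← Real.rpow_mul (hXnn t), show -γ * -(1 / γ) = 1 by field_simp, Real.rpow_one]
      _ ≤ ((X 0) ^ (-γ) / 2) ^ (-(1 / γ)) :=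
          Real.rpow_le_rpow_of_nonpos hX0γ hXtγ (by rw [neg_nonpos]; positivity)
      _ = (2 : ℝ) ^ ((2 * s - 1) / 2) * X 0 := by
          rw [Real.div_rpow (Real.rpow_nonneg (hXnn 0) _) (by norm_num), ← Real.rpow_mul (hXnn 0),
            show -γ * -(1 / γ) = 1 by field_simp, Real.rpow_one, div_eq_mul_inv, ← Real.rpow_neg
            (by norm_num : (0:ℝ) ≤ 2), neg_neg, mul_comm]
          congr 2
          rw [hγ]
          field_simp
  refine ⟨hbound, ?_⟩
  -- ### Step B: continuation by the Serrin criterion at the exponent `q = 6/(3 − 2s₀) > 3`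
  set q : ℝ := 6 / (3 - 2 * s₀) with hq
  have h32s : 0 < 3 - 2 * s₀ := by linarith
  have hq3 : 3 < q := by
    rw [hq, lt_div_iff₀ h32s]; linarith
  have hq0 : 0 < q := by linarith
  set Bnd : ℝ := (2 : ℝ) ^ ((2 * s - 1) / 2) * X 0 with hBnd
  have hBnd0 : 0 ≤ Bnd := mul_nonneg (Real.rpow_nonneg (by norm_num) _) (hXnn 0)
  set N₀ : ℝ := (CE * Bnd) ^ (1 / 2 : ℝ) with hN₀
  have hN₀0 : 0 ≤ N₀ := Real.rpow_nonneg (mul_nonneg hCE0.le hBnd0) _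
  -- `‖u(t)‖²_{Ḣ^{s₀}} ≤ ‖u(t)‖²_{Ḣ^s}` (mean zero: `|k| ≥ 1` on the support)
  have hmono : ∀ t ∈ Ico 0 T, ∑' k : d → ℤ, freqNormSq k ^ s₀ *
      ‖mFourierCoeff (EuclideanSpace.complexify ∘ u t) k‖ ^ 2 ≤ X t := by
    intro t ht
    have hut : IsSmooth (u t) := h.smooth_velocity.isSmooth_slice ht
    refine Summable.tsum_le_tsum (fun k => ?_)
      (hut.summable_freqNormSq_rpow_mul_norm_sq (by linarith))
      (hut.summable_freqNormSq_rpow_mul_norm_sq (by linarith))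
    refine mul_le_mul_of_nonneg_right ?_ (sq_nonneg _)
    by_cases hk : k = 0
    · rw [hk, freqNormSq_zero, Real.zero_rpow (by linarith), Real.zero_rpow (by linarith)]
    · exact Real.rpow_le_rpow_of_exponent_le (one_le_freqNormSq_of_ne_zero hk) hs₀s
  -- `‖u(t)‖_{L^q} ≤ N₀` on `[0, T)`
  have hN : ∀ t ∈ Ico 0 T, (∫ x, ‖u t x‖ ^ q) ^ (1 / q) ≤ N₀ := by
    intro t ht
    have hut : IsSmooth (u t) := h.smooth_velocity.isSmooth_slice ht
    have hE := hCE (u t) hut (hmean t ht)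
    have e1 : 2 * (Fintype.card d : ℝ) / ((Fintype.card d : ℝ) - 2 * s₀) = q := by
      rw [hn, hq]; norm_num
    have e2 : ((Fintype.card d : ℝ) - 2 * s₀) / (Fintype.card d : ℝ) = (1 / q) * 2 := by
      rw [hn, hq]
      field_simp
      norm_num
    rw [e1, e2, Real.rpow_mul (integral_nonneg fun x => Real.rpow_nonneg (norm_nonneg _) _)] at hE
    -- hE : ((∫‖u‖^q)^(1/q))^2 ≤ CE * X_{s₀} t
    have hI0 : 0 ≤ (∫ x, ‖u t x‖ ^ q) ^ (1 / q) :=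
      Real.rpow_nonneg (integral_nonneg fun x => Real.rpow_nonneg (norm_nonneg _) _) _
    have hle : ((∫ x, ‖u t x‖ ^ q) ^ (1 / q)) ^ (2 : ℝ) ≤ CE * Bnd :=
      hE.trans (mul_le_mul_of_nonneg_left ((hmono t ht).trans (hbound t ht)) hCE0.le)
    calc (∫ x, ‖u t x‖ ^ q) ^ (1 / q) = ((((∫ x, ‖u t x‖ ^ q) ^ (1 / q)) ^ (2 : ℝ))) ^ (1 / 2 : ℝ) := by
          rw [← Real.rpow_mul hI0]; norm_num
      _ ≤ (CE * Bnd) ^ (1 / 2 : ℝ) := Real.rpow_le_rpow (Real.rpow_nonneg hI0 _) hle (by norm_num)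
  have hI : ∀ t ∈ Ico 0 T, ∫ τ in (0 : ℝ)..t, (fun _ : ℝ => N₀) τ ^ (2 * q / (q - 3)) ≤
      T * N₀ ^ (2 * q / (q - 3)) := by
    intro t ht
    rw [intervalIntegral.integral_const, smul_eq_mul, sub_zero]
    exact mul_le_mul_of_nonneg_right ht.2.le (Real.rpow_nonneg hN₀0 _)
  exact Torus.classicalNS_continuation_of_Ls_rpow_integral_le hd hν hT hq3 h hmean
    continuousOn_const (fun _ _ => hN₀0) hN hI


/-! ### §6 Windows: the `Ḣ^s` energy at most doubles on windows of length `≲ ν^α ‖u(a)‖_{Ḣ^s}^{-4/(2s-1)}`,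
and the `Ḣ^s` blow-up rate under `Ḣ^s`-unboundedness -/

/-- (General range `1/2 < s < 5/2`, `s ≠ 3/2` — Robinson–Sadowski–Silva 2012, §IV: "Thus for
`1/2 < s < 3/2` and `3/2 < s < 5/2` we obtain the rate of blowup in (2.2)"; for `s > 3/2` the rate law
comes from the commutator estimate (3.6), `NSSobolev.hsSeminorm_sq_deriv_le_rpow'`, and the
continuation step uses the level `min s 1`.)
**Window bound**: for `card d = 3`, `1/2 < s < 3/2` there is `c₀ = c₀(s) > 0` such that for a
classical mean-zero solution on a closed window `[a, b] × T³` (zero force) with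
`(b − a) (‖u(a)‖²_{Ḣ^s})^{2/(2s−1)} ≤ c₀ ν^{(5−2s)/(2s−1)}` one has
`‖u(t)‖²_{Ḣ^s} ≤ 2^{(2s−1)/2} ‖u(a)‖²_{Ḣ^s}` for all `t ∈ [a, b]` (comparison for the rate law
`NSSobolev.hsSeminorm_sq_deriv_le_rpow`: the regularised quantity `(X+δ)^{−γ} + γκt`,
`γ = 2/(2s−1)`, is non-decreasing; Robinson–Sadowski–Silva (4.1)).
[cite: RobinsonSadowskiSilva2012, §IV (4.1)] -/
theorem hsSeminorm_sq_le_of_window' (hd : Fintype.card d = 3) {s : ℝ}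
    (hs : 1 / 2 < s) (hs' : s < 5 / 2) (hs3 : s ≠ 3 / 2) :
    ∃ c₀ : ℝ, 0 < c₀ ∧ ∀ {ν a b : ℝ}, 0 < ν → a < b →
      ∀ {u : ℝ → UnitAddTorus d → EuclideanSpace ℝ d} {p : ℝ → UnitAddTorus d → ℝ},
      Torus.IsClassicalNSSolutionOn (Icc a b) ν 0 u p → (∀ t ∈ Icc a b, HasZeroMean (u t)) →
      (b - a) * (∑' k : d → ℤ, freqNormSq k ^ s *
          ‖mFourierCoeff (EuclideanSpace.complexify ∘ u a) k‖ ^ 2) ^ (2 / (2 * s - 1)) ≤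
        c₀ * ν ^ ((5 - 2 * s) / (2 * s - 1)) →
      ∀ t ∈ Icc a b, (∑' k : d → ℤ, freqNormSq k ^ s *
          ‖mFourierCoeff (EuclideanSpace.complexify ∘ u t) k‖ ^ 2) ≤
        (2 : ℝ) ^ ((2 * s - 1) / 2) * ∑' k : d → ℤ, freqNormSq k ^ s *
          ‖mFourierCoeff (EuclideanSpace.complexify ∘ u a) k‖ ^ 2 := by
  classical
  have hn : (Fintype.card d : ℝ) = 3 := by rw [hd]; norm_num
  obtain ⟨c, hc0, hc⟩ := hsSeminorm_sq_deriv_le_rpow' hd hs hs' hs3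
  set γ : ℝ := 2 / (2 * s - 1) with hγ
  set β : ℝ := (2 * s + 1) / (2 * s - 1) with hβ
  set α : ℝ := (5 - 2 * s) / (2 * s - 1) with hα
  have hs1 : (0 : ℝ) < 2 * s - 1 := by linarith
  have hγ0 : 0 < γ := by rw [hγ]; positivity
  have hβγ : β = 1 + γ := by rw [hβ, hγ]; field_simp; ring
  have hβ1 : 1 < β := by rw [hβγ]; linarith
  set c₀ : ℝ := 1 / (2 * γ * (c + 1)) with hc₀
  have hc₀0 : 0 < c₀ := by rw [hc₀]; positivity
  refine ⟨c₀, hc₀0, fun {ν a b} hν hab {u p} h hmean hsmall t ht => ?_⟩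
  set κ : ℝ := c * ν ^ (-α) with hκ
  have hκ0 : 0 ≤ κ := mul_nonneg hc0 (Real.rpow_nonneg hν.le _)
  set X : ℝ → ℝ := fun τ => ∑' k : d → ℤ, freqNormSq k ^ s *
    ‖mFourierCoeff (EuclideanSpace.complexify ∘ u τ) k‖ ^ 2 with hX
  have hXnn : ∀ τ, 0 ≤ X τ := fun τ => tsum_nonneg fun k =>
    mul_nonneg (Real.rpow_nonneg (freqNormSq_nonneg k) _) (sq_nonneg _)
  show X t ≤ (2 : ℝ) ^ ((2 * s - 1) / 2) * X a
  -- `γ κ (b − a) ≤ X(a)^{-γ} / 2` when `X(a) > 0`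
  have hTκ : 0 < X a → γ * κ * (b - a) ≤ (X a) ^ (-γ) / 2 := by
    intro hXa0
    have h1 : b - a ≤ c₀ * ν ^ α * (X a) ^ (-γ) := by
      have hXγ : 0 < X a ^ γ := Real.rpow_pos_of_pos hXa0 γ
      rw [Real.rpow_neg (hXnn a), ← div_eq_mul_inv, le_div_iff₀ hXγ]
      exact hsmall
    have h2 : γ * κ * (c₀ * ν ^ α * (X a) ^ (-γ)) ≤ (X a) ^ (-γ) / 2 := by
      rw [hκ, hc₀]
      have hνα : ν ^ (-α) * ν ^ α = 1 := by
        rw [← Real.rpow_add hν, neg_add_cancel, Real.rpow_zero]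
      have hXγ0 : 0 ≤ X a ^ (-γ) := Real.rpow_nonneg (hXnn a) _
      calc γ * (c * ν ^ (-α)) * (1 / (2 * γ * (c + 1)) * ν ^ α * X a ^ (-γ))
          = (c / (c + 1)) * (ν ^ (-α) * ν ^ α) * X a ^ (-γ) / 2 := by
            field_simp
        _ ≤ 1 * 1 * X a ^ (-γ) / 2 := by
            rw [hνα]
            gcongr
            · rw [div_le_one (by linarith)]; linarith
        _ = X a ^ (-γ) / 2 := by ring
    calc γ * κ * (b - a) ≤ γ * κ * (c₀ * ν ^ α * (X a) ^ (-γ)) :=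
          mul_le_mul_of_nonneg_left h1 (mul_nonneg hγ0.le hκ0)
      _ ≤ (X a) ^ (-γ) / 2 := h2
  have hmean' : ∀ τ ∈ Icc a b, HasZeroMean (u τ) := hmean
  have hXc : ContinuousOn X (Icc a b) :=
    continuousOn_tsum_rpow_mul_norm_sq hab h.smooth_velocity (by linarith) (by rw [hn]; linarith)
  have hXd : ∀ τ ∈ Ioo a b, HasDerivAt X (deriv X τ) τ ∧ deriv X τ ≤ κ * X τ ^ β := by
    intro τ hτ
    obtain ⟨D, hD, hle⟩ := hc hν hab h hmean' τ hτ
    refine ⟨hD.differentiableAt.hasDerivAt, ?_⟩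
    rw [hD.deriv]
    refine hle.trans ?_
    have hZ0 : 0 ≤ ∑' k : d → ℤ, freqNormSq k ^ (s + 1) *
        ‖mFourierCoeff (EuclideanSpace.complexify ∘ u τ) k‖ ^ 2 := tsum_nonneg fun k =>
      mul_nonneg (Real.rpow_nonneg (freqNormSq_nonneg k) _) (sq_nonneg _)
    have hneg : -(4 * Real.pi ^ 2 * ν) * (∑' k : d → ℤ, freqNormSq k ^ (s + 1) *
        ‖mFourierCoeff (EuclideanSpace.complexify ∘ u τ) k‖ ^ 2) ≤ 0 :=
      mul_nonpos_of_nonpos_of_nonneg (by have := Real.pi_pos; nlinarith [hν]) hZ0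
    have : c * ν ^ (-((5 - 2 * s) / (2 * s - 1))) * X τ ^ ((2 * s + 1) / (2 * s - 1)) =
        κ * X τ ^ β := by rw [hκ, hα, hβ]
    linarith [this]
  have hcomp := fun (δ : ℝ) (hδ : 0 < δ) =>
    rpow_add_le_of_deriv_le (X := X) (X' := deriv X) hab hκ0 hβ1 (fun τ _ => hXnn τ) hXc
      (fun τ hτ => (hXd τ hτ).1) (fun τ hτ => (hXd τ hτ).2) hδ ht
  have h1β : 1 - β = -γ := by rw [hβγ]; ring
  have hβ1' : β - 1 = γ := by rw [hβγ]; ring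
  by_cases hXt : X t = 0
  · rw [hXt]; exact mul_nonneg (Real.rpow_nonneg (by norm_num) _) (hXnn a)
  have hXt0 : 0 < X t := lt_of_le_of_ne (hXnn t) (Ne.symm hXt)
  have htT : (β - 1) * κ * (t - a) ≤ γ * κ * (b - a) := by
    rw [hβ1']
    exact mul_le_mul_of_nonneg_left (by linarith [ht.2]) (mul_nonneg hγ0.le hκ0)
  have hkey : ∀ δ : ℝ, 0 < δ → (X a + δ) ^ (-γ) ≤ X t ^ (-γ) + γ * κ * (b - a) := by
    intro δ hδ
    have h1 := hcomp δ hδ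
    rw [h1β] at h1
    have h2 : (X t + δ) ^ (-γ) ≤ X t ^ (-γ) :=
      Real.rpow_le_rpow_of_nonpos hXt0 (by linarith) (by linarith)
    linarith
  have hXa0 : 0 < X a := by
    by_contra hcon
    have hX0z : X a = 0 := le_antisymm (not_lt.1 hcon) (hXnn a)
    set R₀ : ℝ := X t ^ (-γ) + γ * κ * (b - a) + 1 with hR₀
    have hR₀0 : 0 < R₀ := by
      have := Real.rpow_nonneg (hXnn t) (-γ)
      have := mul_nonneg (mul_nonneg hγ0.le hκ0) (by linarith : (0 : ℝ) ≤ b - a)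
      rw [hR₀]; linarith
    set δ : ℝ := R₀ ^ (-(1 / γ)) with hδ
    have hδ0 : 0 < δ := Real.rpow_pos_of_pos hR₀0 _
    have hδγ : δ ^ (-γ) = R₀ := by
      rw [hδ, ← Real.rpow_mul hR₀0.le, show -(1 / γ) * -γ = 1 by field_simp, Real.rpow_one]
    have := hkey δ hδ0
    rw [hX0z, zero_add, hδγ, hR₀] at this
    linarith
  have hlim : (X a) ^ (-γ) ≤ X t ^ (-γ) + γ * κ * (b - a) := by
    by_contra hcon
    push Not at hcon
    have hcont : Filter.Tendsto (fun δ : ℝ => (X a + δ) ^ (-γ)) (𝓝 0) (𝓝 ((X a) ^ (-γ))) := by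
      have h1 : ContinuousAt (fun δ : ℝ => (X a + δ) ^ (-γ)) 0 :=
        (continuousAt_const.add continuousAt_id).rpow_const (Or.inl (by simp; exact hXa0.ne'))
      have h2 := h1.tendsto
      simp only [add_zero] at h2
      exact h2
    have hev := (hcont.eventually_const_lt hcon).filter_mono (nhdsWithin_le_nhds (s := Ioi (0:ℝ)))
    obtain ⟨δ, hδ0, hδ⟩ := ((eventually_mem_nhdsWithin (a := (0:ℝ)) (s := Ioi 0)).and hev).exists
    exact absurd (hkey δ hδ0) (not_le.2 hδ)
  have hXtγ : (X a) ^ (-γ) / 2 ≤ X t ^ (-γ) := by linarith [hTκ hXa0]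
  have hX0γ : 0 < (X a) ^ (-γ) / 2 := by
    have := Real.rpow_pos_of_pos hXa0 (-γ); linarith
  calc X t = (X t ^ (-γ)) ^ (-(1 / γ)) := by
        rw [← Real.rpow_mul (hXnn t), show -γ * -(1 / γ) = 1 by field_simp, Real.rpow_one]
    _ ≤ ((X a) ^ (-γ) / 2) ^ (-(1 / γ)) :=
        Real.rpow_le_rpow_of_nonpos hX0γ hXtγ (by rw [neg_nonpos]; positivity)
    _ = (2 : ℝ) ^ ((2 * s - 1) / 2) * X a := by
        rw [Real.div_rpow (Real.rpow_nonneg (hXnn a) _) (by norm_num), ← Real.rpow_mul (hXnn a),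
          show -γ * -(1 / γ) = 1 by field_simp, Real.rpow_one, div_eq_mul_inv, ← Real.rpow_neg
          (by norm_num : (0:ℝ) ≤ 2), neg_neg, mul_comm]
        congr 2
        rw [hγ]
        field_simp

/-- (General range `1/2 < s < 5/2`, `s ≠ 3/2` — Robinson–Sadowski–Silva 2012, §IV: "Thus for
`1/2 < s < 3/2` and `3/2 < s < 5/2` we obtain the rate of blowup in (2.2)"; for `s > 3/2` the rate law
comes from the commutator estimate (3.6), `NSSobolev.hsSeminorm_sq_deriv_le_rpow'`, and the
continuation step uses the level `min s 1`.)
**The `Ḣ^s` blow-up rate from the `Ḣ^s` balance** (Robinson–Sadowski–Silva 2012, §IV with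
(2.2)/(4.2): "if a solution blows up at time `T` then `‖u(T − t)‖_{Ḣ^s} ≥ c_s t^{−(2s−1)/4}`",
`1/2 < s < 3/2`), classical torus form, `ν`-scaled, under unboundedness of the `Ḣ^s` norm itself:
for `card d = 3` and `1/2 < s < 3/2` there is `c₀ = c₀(s) > 0` such that every classical mean-zero
solution on `[a, T) × T³` (zero force) whose `Ḣ^s` energy `X(t) = ∑_k |k|^{2s}‖û(t,k)‖²` is
unbounded on `[a, T)` satisfies `X(t) ≥ (c₀ ν^{(5−2s)/(2s−1)} / (T − t))^{(2s−1)/2}` for all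
`t ∈ [a, T)`, i.e. `‖u(t)‖_{Ḣ^s} ≥ c ν^{(5−2s)/4} (T − t)^{−(2s−1)/4}` (otherwise the window bound
`NSSobolev.hsSeminorm_sq_le_of_window` caps `X` on `[t, T)`, and `X` is continuous on `[a, t]`).
Compare `Torus.hsSeminorm_blowup_rate` (`TorusNSSobolevBlowupRate`: the same rate by the Leray–`L^q`
route, under unboundedness of `∫‖u‖^{6/(3−2s)}`). [cite: RobinsonSadowskiSilva2012, §IV (4.2), (2.2)] -/
theorem hsSeminorm_sq_blowup_rate' (hd : Fintype.card d = 3) {s : ℝ} (hs : 1 / 2 < s)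
    (hs' : s < 5 / 2) (hs3 : s ≠ 3 / 2) :
    ∃ c₀ : ℝ, 0 < c₀ ∧ ∀ {ν a T : ℝ}, 0 < ν →
      ∀ {u : ℝ → UnitAddTorus d → EuclideanSpace ℝ d} {p : ℝ → UnitAddTorus d → ℝ},
      Torus.IsClassicalNSSolutionOn (Ico a T) ν 0 u p → (∀ t ∈ Ico a T, HasZeroMean (u t)) →
      ¬ BddAbove ((fun t => ∑' k : d → ℤ, freqNormSq k ^ s *
          ‖mFourierCoeff (EuclideanSpace.complexify ∘ u t) k‖ ^ 2) '' Ico a T) →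
      ∀ t ∈ Ico a T, (c₀ * ν ^ ((5 - 2 * s) / (2 * s - 1)) / (T - t)) ^ ((2 * s - 1) / 2) ≤
        ∑' k : d → ℤ, freqNormSq k ^ s * ‖mFourierCoeff (EuclideanSpace.complexify ∘ u t) k‖ ^ 2 := by
  classical
  have hn : (Fintype.card d : ℝ) = 3 := by rw [hd]; norm_num
  obtain ⟨c₀, hc₀0, hW⟩ := hsSeminorm_sq_le_of_window' hd hs hs' hs3
  refine ⟨c₀, hc₀0, fun {ν a T} hν {u p} h hmean hunb t ht => ?_⟩
  have hs1 : (0 : ℝ) < 2 * s - 1 := by linarith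
  set γ : ℝ := 2 / (2 * s - 1) with hγ
  have hγ0 : 0 < γ := by rw [hγ]; positivity
  set α : ℝ := (5 - 2 * s) / (2 * s - 1) with hα
  set X : ℝ → ℝ := fun τ => ∑' k : d → ℤ, freqNormSq k ^ s *
    ‖mFourierCoeff (EuclideanSpace.complexify ∘ u τ) k‖ ^ 2 with hX
  have hXnn : ∀ τ, 0 ≤ X τ := fun τ => tsum_nonneg fun k =>
    mul_nonneg (Real.rpow_nonneg (freqNormSq_nonneg k) _) (sq_nonneg _)
  show (c₀ * ν ^ α / (T - t)) ^ ((2 * s - 1) / 2) ≤ X t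
  have htT : 0 < T - t := by linarith [ht.2]
  have hL0 : 0 < c₀ * ν ^ α / (T - t) := div_pos (mul_pos hc₀0 (Real.rpow_pos_of_pos hν _)) htT
  by_contra hlt
  rw [not_le] at hlt
  -- then `(T - t) X(t)^γ < c₀ ν^α`
  have hsmall : (T - t) * X t ^ γ < c₀ * ν ^ α := by
    have h1 : X t ^ γ < ((c₀ * ν ^ α / (T - t)) ^ ((2 * s - 1) / 2)) ^ γ :=
      Real.rpow_lt_rpow (hXnn t) hlt hγ0
    rw [← Real.rpow_mul hL0.le, show (2 * s - 1) / 2 * γ = 1 by rw [hγ]; field_simp,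
      Real.rpow_one] at h1
    calc (T - t) * X t ^ γ < (T - t) * (c₀ * ν ^ α / (T - t)) := mul_lt_mul_of_pos_left h1 htT
      _ = c₀ * ν ^ α := by field_simp
  apply hunb
  -- bound on `[t, T)` from the window lemma, on `[a, t]` by continuity
  have hright : ∀ τ ∈ Ico t T, X τ ≤ (2 : ℝ) ^ ((2 * s - 1) / 2) * X t := by
    intro τ hτ
    rcases hτ.1.eq_or_lt with h0 | htτ
    · rw [← h0]
      have : (1 : ℝ) ≤ (2 : ℝ) ^ ((2 * s - 1) / 2) := Real.one_le_rpow (by norm_num) (by positivity)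
      nlinarith [hXnn t]
    · set b : ℝ := (τ + T) / 2 with hb
      have hτb : τ < b := by rw [hb]; linarith [hτ.2]
      have hbT : b < T := by rw [hb]; linarith [hτ.2]
      have htb : t < b := htτ.trans hτb
      have hsub : Icc t b ⊆ Ico a T := fun r hr => ⟨ht.1.trans hr.1, lt_of_le_of_lt hr.2 hbT⟩
      have h' : Torus.IsClassicalNSSolutionOn (Icc t b) ν 0 u p := h.mono hsub (uniqueDiffOn_Icc htb)
      have hsm : (b - t) * X t ^ γ ≤ c₀ * ν ^ α := by
        have : (b - t) * X t ^ γ ≤ (T - t) * X t ^ γ :=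
          mul_le_mul_of_nonneg_right (by linarith) (Real.rpow_nonneg (hXnn t) _)
        linarith
      exact hW hν htb h' (fun r hr => hmean r (hsub hr)) hsm τ ⟨htτ.le, hτb.le⟩
  -- the left part `[a, t]`
  have hleft : BddAbove (X '' Icc a t) := by
    rcases ht.1.eq_or_lt with h0 | hat
    · rw [← h0, Set.Icc_self, Set.image_singleton]
      exact bddAbove_singleton
    · have hsub : Icc a t ⊆ Ico a T := fun r hr => ⟨hr.1, lt_of_le_of_lt hr.2 ht.2⟩
      have h' : Torus.IsClassicalNSSolutionOn (Icc a t) ν 0 u p := h.mono hsub (uniqueDiffOn_Icc hat)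
      have hXc : ContinuousOn X (Icc a t) :=
        continuousOn_tsum_rpow_mul_norm_sq hat h'.smooth_velocity (by linarith) (by rw [hn]; linarith)
      exact (isCompact_Icc.image_of_continuousOn hXc).bddAbove
  obtain ⟨B₁, hB₁⟩ := hleft
  refine ⟨max B₁ ((2 : ℝ) ^ ((2 * s - 1) / 2) * X t), ?_⟩
  rintro _ ⟨τ, hτ, rfl⟩
  rcases le_or_gt τ t with hτt | htτ
  · exact (hB₁ ⟨τ, ⟨hτ.1, hτt⟩, rfl⟩).trans (le_max_left _ _)
  · exact (hright τ ⟨htτ.le, hτ.2⟩).trans (le_max_right _ _)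


/-! ### §7 The original range `1/2 < s < 3/2` (corollaries) -/

/-- (Range `1/2 < s < 3/2`; the general case `s < 5/2`, `s ≠ 3/2` is the primed version.)
**The `Ḣ^s` norm controls its own lifespan** (Robinson–Sadowski–Silva 2012: the law
`d/dt‖u‖_s² ≤ c_s‖u‖_s^{2(2s+1)/(2s−1)}` shows "that the local existence time depends only on the
norm in `Ḣ^s`", and by the scaling of §II that time is `≳ ‖u₀‖_{Ḣ^s}^{−4/(2s−1)}`;
`1/2 < s < 3/2`), continuation form for classical solutions on `T³` with the viscosity explicit:
for `card d = 3` and `1/2 < s < 3/2` there is `c₀ = c₀(s) > 0` such that a classical mean-zero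
solution on `[0, T) × T³` (zero force) with
`T · (‖u(0)‖²_{Ḣ^s})^{2/(2s−1)} ≤ c₀ ν^{(5−2s)/(2s−1)}` (`‖u‖²_{Ḣ^s} = ∑_k |k|^{2s}‖û(k)‖²`)
satisfies `‖u(t)‖²_{Ḣ^s} ≤ 2^{(2s−1)/2} ‖u(0)‖²_{Ḣ^s}` on `[0, T)` and extends to a classical
mean-zero solution on a strictly longer closed interval (comparison for the rate law
`NSSobolev.hsSeminorm_sq_deriv_le_rpow`, then `Ḣ^s ⊂ L^{6/(3−2s)}`
(`Torus.exists_rpow_integral_rpow_norm_le_hsSeminorm`) and the Serrin-type continuation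
`Torus.classicalNS_continuation_of_Ls_rpow_integral_le`). In particular no `Ḣ^s` blow-up occurs
before time `c₀ ν^{(5−2s)/(2s−1)} ‖u(0)‖_{Ḣ^s}^{−4/(2s−1)}`.
[cite: RobinsonSadowskiSilva2012, §IV with §II (2.2)] -/
theorem classicalNS_continuation_of_hsSeminorm_lifespan (hd : Fintype.card d = 3) {s : ℝ}
    (hs : 1 / 2 < s) (hs' : s < 3 / 2) :
    ∃ c₀ : ℝ, 0 < c₀ ∧ ∀ {ν T : ℝ}, 0 < ν → 0 < T →
      ∀ {u : ℝ → UnitAddTorus d → EuclideanSpace ℝ d} {p : ℝ → UnitAddTorus d → ℝ},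
      Torus.IsClassicalNSSolutionOn (Ico 0 T) ν 0 u p → (∀ t ∈ Ico 0 T, HasZeroMean (u t)) →
      T * (∑' k : d → ℤ, freqNormSq k ^ s *
          ‖mFourierCoeff (EuclideanSpace.complexify ∘ u 0) k‖ ^ 2) ^ (2 / (2 * s - 1)) ≤
        c₀ * ν ^ ((5 - 2 * s) / (2 * s - 1)) →
      (∀ t ∈ Ico 0 T, (∑' k : d → ℤ, freqNormSq k ^ s *
          ‖mFourierCoeff (EuclideanSpace.complexify ∘ u t) k‖ ^ 2) ≤
        (2 : ℝ) ^ ((2 * s - 1) / 2) * ∑' k : d → ℤ, freqNormSq k ^ s *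
          ‖mFourierCoeff (EuclideanSpace.complexify ∘ u 0) k‖ ^ 2) ∧
      ∃ T' : ℝ, T < T' ∧ ∃ (u' : ℝ → UnitAddTorus d → EuclideanSpace ℝ d)
        (p' : ℝ → UnitAddTorus d → ℝ), Torus.IsClassicalNSSolutionOn (Icc 0 T') ν 0 u' p' ∧
          (∀ t ∈ Icc 0 T', HasZeroMean (u' t)) ∧ ∀ t ∈ Ico 0 T, u' t = u t :=
  classicalNS_continuation_of_hsSeminorm_lifespan' hd hs (by linarith) hs'.ne

/-- (Range `1/2 < s < 3/2`; the general case `s < 5/2`, `s ≠ 3/2` is the primed version.)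
**Window bound**: for `card d = 3`, `1/2 < s < 3/2` there is `c₀ = c₀(s) > 0` such that for a
classical mean-zero solution on a closed window `[a, b] × T³` (zero force) with
`(b − a) (‖u(a)‖²_{Ḣ^s})^{2/(2s−1)} ≤ c₀ ν^{(5−2s)/(2s−1)}` one has
`‖u(t)‖²_{Ḣ^s} ≤ 2^{(2s−1)/2} ‖u(a)‖²_{Ḣ^s}` for all `t ∈ [a, b]` (comparison for the rate law
`NSSobolev.hsSeminorm_sq_deriv_le_rpow`: the regularised quantity `(X+δ)^{−γ} + γκt`,
`γ = 2/(2s−1)`, is non-decreasing; Robinson–Sadowski–Silva (4.1)).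
[cite: RobinsonSadowskiSilva2012, §IV (4.1)] -/
theorem hsSeminorm_sq_le_of_window (hd : Fintype.card d = 3) {s : ℝ}
    (hs : 1 / 2 < s) (hs' : s < 3 / 2) :
    ∃ c₀ : ℝ, 0 < c₀ ∧ ∀ {ν a b : ℝ}, 0 < ν → a < b →
      ∀ {u : ℝ → UnitAddTorus d → EuclideanSpace ℝ d} {p : ℝ → UnitAddTorus d → ℝ},
      Torus.IsClassicalNSSolutionOn (Icc a b) ν 0 u p → (∀ t ∈ Icc a b, HasZeroMean (u t)) →
      (b - a) * (∑' k : d → ℤ, freqNormSq k ^ s *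
          ‖mFourierCoeff (EuclideanSpace.complexify ∘ u a) k‖ ^ 2) ^ (2 / (2 * s - 1)) ≤
        c₀ * ν ^ ((5 - 2 * s) / (2 * s - 1)) →
      ∀ t ∈ Icc a b, (∑' k : d → ℤ, freqNormSq k ^ s *
          ‖mFourierCoeff (EuclideanSpace.complexify ∘ u t) k‖ ^ 2) ≤
        (2 : ℝ) ^ ((2 * s - 1) / 2) * ∑' k : d → ℤ, freqNormSq k ^ s *
          ‖mFourierCoeff (EuclideanSpace.complexify ∘ u a) k‖ ^ 2 :=
  hsSeminorm_sq_le_of_window' hd hs (by linarith) hs'.ne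

/-- (Range `1/2 < s < 3/2`; the general case `s < 5/2`, `s ≠ 3/2` is the primed version.)
**The `Ḣ^s` blow-up rate from the `Ḣ^s` balance** (Robinson–Sadowski–Silva 2012, §IV with
(2.2)/(4.2): "if a solution blows up at time `T` then `‖u(T − t)‖_{Ḣ^s} ≥ c_s t^{−(2s−1)/4}`",
`1/2 < s < 3/2`), classical torus form, `ν`-scaled, under unboundedness of the `Ḣ^s` norm itself:
for `card d = 3` and `1/2 < s < 3/2` there is `c₀ = c₀(s) > 0` such that every classical mean-zero
solution on `[a, T) × T³` (zero force) whose `Ḣ^s` energy `X(t) = ∑_k |k|^{2s}‖û(t,k)‖²` is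
unbounded on `[a, T)` satisfies `X(t) ≥ (c₀ ν^{(5−2s)/(2s−1)} / (T − t))^{(2s−1)/2}` for all
`t ∈ [a, T)`, i.e. `‖u(t)‖_{Ḣ^s} ≥ c ν^{(5−2s)/4} (T − t)^{−(2s−1)/4}` (otherwise the window bound
`NSSobolev.hsSeminorm_sq_le_of_window` caps `X` on `[t, T)`, and `X` is continuous on `[a, t]`).
Compare `Torus.hsSeminorm_blowup_rate` (`TorusNSSobolevBlowupRate`: the same rate by the Leray–`L^q`
route, under unboundedness of `∫‖u‖^{6/(3−2s)}`). [cite: RobinsonSadowskiSilva2012, §IV (4.2), (2.2)] -/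
theorem hsSeminorm_sq_blowup_rate (hd : Fintype.card d = 3) {s : ℝ} (hs : 1 / 2 < s)
    (hs' : s < 3 / 2) :
    ∃ c₀ : ℝ, 0 < c₀ ∧ ∀ {ν a T : ℝ}, 0 < ν →
      ∀ {u : ℝ → UnitAddTorus d → EuclideanSpace ℝ d} {p : ℝ → UnitAddTorus d → ℝ},
      Torus.IsClassicalNSSolutionOn (Ico a T) ν 0 u p → (∀ t ∈ Ico a T, HasZeroMean (u t)) →
      ¬ BddAbove ((fun t => ∑' k : d → ℤ, freqNormSq k ^ s *
          ‖mFourierCoeff (EuclideanSpace.complexify ∘ u t) k‖ ^ 2) '' Ico a T) →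
      ∀ t ∈ Ico a T, (c₀ * ν ^ ((5 - 2 * s) / (2 * s - 1)) / (T - t)) ^ ((2 * s - 1) / 2) ≤
        ∑' k : d → ℤ, freqNormSq k ^ s * ‖mFourierCoeff (EuclideanSpace.complexify ∘ u t) k‖ ^ 2 :=
  hsSeminorm_sq_blowup_rate' hd hs (by linarith) hs'.ne

/-! ### §8 The `Ḣ^s` blow-up rate under enstrophy blow-up, `1 ≤ s < 5/2`, `s ≠ 3/2` -/

/-- **The `Ḣ^s` blow-up rate under the classical (enstrophy) blow-up hypothesis, for every
`1 ≤ s < 5/2`, `s ≠ 3/2`** (Robinson–Sadowski–Silva 2012, (2.2): "`‖u(T − t)‖_{Ḣ^s} ≥ c t^{−(2s−1)/4}`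
… for `1/2 < s < 5/2`, `s ≠ 3/2`"), classical torus form: for `card d = 3` there is
`c₀ = c₀(s) > 0` such that every classical mean-zero solution on `[a, T) × T³` (zero force) with
`‖∇u(t)‖₂²` unbounded on `[a, T)` satisfies
`∑_k |k|^{2s}‖û(t,k)‖² ≥ (c₀ ν^{(5−2s)/(2s−1)} / (T − t))^{(2s−1)/2}` for all `t ∈ [a, T)`
(mean zero and `s ≥ 1` give `‖∇u‖₂² = 4π²∑|k|²‖û‖² ≤ 4π² ∑|k|^{2s}‖û‖²`, so the `Ḣ^s` energy is
unbounded too; then `NSSobolev.hsSeminorm_sq_blowup_rate'`). The range `1/2 < s < 3/2` under the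
same hypothesis is `Torus.hsSeminorm_blowup_rate_of_not_bddAbove_gradNormSq`
(`TorusNSSobolevBlowupRate`, Leray–`L^q` route). [cite: RobinsonSadowskiSilva2012, §II (2.2), §IV (4.2)] -/
theorem hsSeminorm_sq_blowup_rate_of_not_bddAbove_gradNormSq' (hd : Fintype.card d = 3) {s : ℝ}
    (hs1 : 1 ≤ s) (hs' : s < 5 / 2) (hs3 : s ≠ 3 / 2) :
    ∃ c₀ : ℝ, 0 < c₀ ∧ ∀ {ν a T : ℝ}, 0 < ν →
      ∀ {u : ℝ → UnitAddTorus d → EuclideanSpace ℝ d} {p : ℝ → UnitAddTorus d → ℝ},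
      Torus.IsClassicalNSSolutionOn (Ico a T) ν 0 u p → (∀ t ∈ Ico a T, HasZeroMean (u t)) →
      ¬ BddAbove ((fun t => Torus.gradNormSq (u t)) '' Ico a T) →
      ∀ t ∈ Ico a T, (c₀ * ν ^ ((5 - 2 * s) / (2 * s - 1)) / (T - t)) ^ ((2 * s - 1) / 2) ≤
        ∑' k : d → ℤ, freqNormSq k ^ s * ‖mFourierCoeff (EuclideanSpace.complexify ∘ u t) k‖ ^ 2 := by
  classical
  obtain ⟨c₀, hc₀, H⟩ := hsSeminorm_sq_blowup_rate' hd (by linarith) hs' hs3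
  refine ⟨c₀, hc₀, fun {ν a T} hν {u p} h hmean hunb t ht => H hν h hmean ?_ t ht⟩
  -- the `Ḣ^s` energy dominates the enstrophy, hence is unbounded
  intro hbdd
  apply hunb
  obtain ⟨M, hM⟩ := hbdd
  refine ⟨4 * Real.pi ^ 2 * M, ?_⟩
  rintro _ ⟨τ, hτ, rfl⟩
  have hX : ∑' k : d → ℤ, freqNormSq k ^ s *
      ‖mFourierCoeff (EuclideanSpace.complexify ∘ u τ) k‖ ^ 2 ≤ M := hM ⟨τ, hτ, rfl⟩
  have huτ : IsSmooth (u τ) := h.smooth_velocity.isSmooth_slice hτ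
  have hG := hasSum_freqNormSq_mul_norm_sq_mFourierCoeff huτ
  have hXs := huτ.summable_freqNormSq_rpow_mul_norm_sq (by linarith : (0 : ℝ) ≤ s)
  have hle : Torus.gradNormSq (u τ) ≤ 4 * Real.pi ^ 2 * ∑' k : d → ℤ, freqNormSq k ^ s *
      ‖mFourierCoeff (EuclideanSpace.complexify ∘ u τ) k‖ ^ 2 := by
    rw [← hG.tsum_eq, ← tsum_mul_left]
    refine Summable.tsum_le_tsum (fun k => ?_) hG.summable (hXs.mul_left _)
    rw [← mul_assoc]
    refine mul_le_mul_of_nonneg_right (mul_le_mul_of_nonneg_left ?_ (by positivity)) (sq_nonneg _)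
    by_cases hk : k = 0
    · rw [hk, freqNormSq_zero, Real.zero_rpow (by linarith)]
    · calc freqNormSq k = freqNormSq k ^ (1 : ℝ) := (Real.rpow_one _).symm
        _ ≤ freqNormSq k ^ s :=
            Real.rpow_le_rpow_of_exponent_le (one_le_freqNormSq_of_ne_zero hk) hs1
  show Torus.gradNormSq (u τ) ≤ 4 * Real.pi ^ 2 * M
  exact hle.trans (mul_le_mul_of_nonneg_left hX (by positivity))


end NSSobolev

end Literature.Analysis.FluidPDE

end
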